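import Summits.HubbardSuperconductivity.HubbardSuperconductivity.Theorems.AnisotropyChordTransferFibre3FinXCCert

/-!
# Route `AnisotropyChord` / H0 rotor rung: FIN small-`L` — the COMBINED row-`N₁` + row-C cell certificate is sound

★★ `xbc_cell_sound : xbcCellOK L la lb c bn bd = true →` (`c·U ≤ N₁`, via `xb_cell_sound` on the first conjunct) `∧` (the
bracket tuple `∃ Chi Nhi Plo Llo Tlo Thi, …` of p1's `KT2Assembly.offPoleTailAbs_of_brackets` with `b = bn/bd`, `Plo = Llo = 0`
by `polePartNonneg_holds`/`lowNormPartNonneg_holds`, `Chi`/`Nhi`/`Tlo`/`Thi` from `xcObj_sound`, `tPlusLo_le`, `le_tPlusHi`)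
for every ground two-magnon profile of the cell (`5 ≤ L`, `0 < Δ < 1`).
Prover seat `hubbard-h0-rotor-p3` g5; helper for piece A = stmt-HubbardSuperconductivity-23918 of rung 19089 (`--supports`, helper
class).  WHAT THIS IS NOT: nothing here proves superconductivity in the Hubbard model (rotor TARGET as worded stays FALSE, g15 verdict);
two hypotheses (rows `N₁`, C per `L` per cell) of ONE conditional reduction.  Tree imports only; no sorry, no new axioms.
-/

set_option linter.dupNamespace false
set_option autoImplicit false

namespace Summit.HubbardSuperconductivity.HubbardSuperconductivity.Theorems.AnisotropyChord.Transfer.Fibre3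

namespace FinXB

open scoped BigOperators
open Finset Hole2 FinCell

variable {L : ℕ} [NeZero L]

/-- ★★ THE COMBINED CELL CERTIFICATE IS SOUND: row `N₁` (`c·U ≤ N₁`) and the row-C bracket tuple of
`KT2Assembly.offPoleTailAbs_of_brackets` (`b = bn/bd`) for every ground profile of the cell. [folklore] -/
theorem xbc_cell_sound (hL : 5 ≤ L) {Δ lam2 : ℝ} (hΔ0 : 0 < Δ) (hΔ1 : Δ < 1) {f : Tor L → ℝ}
    (hf : IsGroundTwoMagnon L Δ lam2 f) {la lb : ℤ}
    (hla : (la : ℝ) ≤ lam2 * ((D : ℤ) : ℝ)) (hlb : lam2 * ((D : ℤ) : ℝ) ≤ (lb : ℝ))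
    {c : ℚ} {bn bd : ℕ} (hcert : xbcCellOK L la lb c bn bd = true) :
    (c : ℝ) * Uunit L Δ f ≤ trialGapN1 L Δ f ∧
    ∃ Chi Nhi Plo Llo Tlo Thi : ℝ,
      cs2 L f ≤ Chi ∧ nC0p L Δ f ≤ Nhi ∧ Plo ≤ polePart L Δ f ∧ Llo ≤ lowNormPart L Δ f ∧
      Tlo ≤ Tplus L Δ f ∧ Tplus L Δ f ≤ Thi ∧ Thi ≤ 2 * eps1 L ∧ 0 ≤ Tlo ∧
      (3 * Real.sqrt Chi + 3 * Real.sqrt Nhi) ^ 2 - Plo - Llo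
        ≤ ((bn : ℝ) / bd) * ((L : ℝ) ^ 2 * lam2 / 4) * (2 * eps1 L - Thi) * (3 * ((L : ℝ) ^ 2) ^ 2 * Tlo) := by
  have hsplit : xbCellOK L la lb c = true ∧
      (0 < bd ∧ xcMok L (fTab4 L la lb) (xcObj L la lb (xbEval L la lb).1 (xbEval L la lb).2).M = true ∧
        0 ≤ (xcObj L la lb (xbEval L la lb).1 (xbEval L la lb).2).tlo ∧
        (xcObj L la lb (xbEval L la lb).1 (xbEval L la lb).2).thi ≤ 2 * (xbEval L la lb).1.eps1.1 ∧
        0 ≤ (xcObj L la lb (xbEval L la lb).1 (xbEval L la lb).2).eta.1 ∧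
        sqSum (xcObj L la lb (xbEval L la lb).1 (xbEval L la lb).2)
          ≤ rhsLo L (xbEval L la lb).1 (xcObj L la lb (xbEval L la lb).1 (xbEval L la lb).2) bn bd) := by
    unfold xbcCellOK at hcert
    unfold xbCellOK
    simp only [Bool.and_eq_true, decide_eq_true_eq] at hcert ⊢
    exact ⟨hcert.1, hcert.2.1.1.1.1.1, hcert.2.1.1.1.1.2, hcert.2.1.1.1.2, hcert.2.1.1.2, hcert.2.1.2, hcert.2.2⟩
  obtain ⟨hN1, hbd, hMok, htlo0, hthi, heta0, hineq⟩ := hsplit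
  refine ⟨xb_cell_sound hL hΔ0.le hΔ1 hf hla hlb hN1, ?_⟩
  have hcert' := hN1
  unfold xbCellOK at hcert'
  simp only [Bool.and_eq_true, decide_eq_true_eq] at hcert'
  obtain ⟨⟨⟨⟨hchk, hsc⟩, hP⟩, -⟩, -⟩ := hcert'
  have H : CellHyp (L := L) Δ lam2 f la lb := ⟨hL, hΔ0.le, hΔ1, hf, hla, hlb, hchk, hsc⟩
  have hD := D_pos
  set S := (xbEval L la lb).1 with hSdef
  set O := (xbEval L la lb).2 with hOdef
  set C := xcObj L la lb S O with hCdef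
  obtain ⟨Chi, Nhi, hChi, hNhi, hChi0, hNhi0, mChi, mNhi, mEta⟩ := xcObj_sound H hMok
  have hTlo := tPlusLo_le H hP
  have hThi := le_tPlusHi H hP
  have mlam : mem lam2 S.lam := H.hS.1
  have meps : mem (eps1 L) S.eps1 := H.hS.2.2.2.2.2.2.2.2.2.2
  refine ⟨Chi, Nhi, 0, 0, (C.tlo : ℝ) / ((D : ℤ) : ℝ), (C.thi : ℝ) / ((D : ℤ) : ℝ), hChi, hNhi,
    polePartNonneg_holds L Δ f, lowNormPartNonneg_holds L Δ f, ?_, ?_, ?_, ?_, ?_⟩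
  · rw [div_le_iff₀ hD]; exact hTlo
  · rw [le_div_iff₀ hD]; exact hThi
  · have h1 : ((C.thi : ℤ) : ℝ) ≤ 2 * ((S.eps1.1 : ℤ) : ℝ) := by exact_mod_cast hthi
    rw [div_le_iff₀ hD]
    nlinarith [meps.1]
  · have : (0 : ℝ) ≤ ((C.tlo : ℤ) : ℝ) := by exact_mod_cast htlo0
    positivity
  · rw [sub_zero, sub_zero]
    -- the square of the square roots, in fixed point
    have ms := mem_iadd (mem_iscale 3 (mem_isqrt (Real.sqrt_nonneg Chi) (by rw [Real.sq_sqrt hChi0]; exact mChi)))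
      (mem_iscale 3 (mem_isqrt (Real.sqrt_nonneg Nhi) (by rw [Real.sq_sqrt hNhi0]; exact mNhi)))
    set s := iadd (iscale 3 (isqrt C.chi)) (iscale 3 (isqrt C.nhi)) with hsdef
    obtain ⟨-, hs2⟩ := ms
    push_cast at hs2
    have hv0 : 0 ≤ 3 * Real.sqrt Chi + 3 * Real.sqrt Nhi := by positivity
    have hvle : 3 * Real.sqrt Chi + 3 * Real.sqrt Nhi ≤ (s.2 : ℝ) / ((D : ℤ) : ℝ) := by
      rw [le_div_iff₀ hD]; exact hs2
    have e2 := (mem_imul (mem_ipt s.2) (mem_ipt s.2)).2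
    have hsq : (3 * Real.sqrt Chi + 3 * Real.sqrt Nhi) ^ 2 * ((D : ℤ) : ℝ) ≤ ((sqSum C : ℤ) : ℝ) := by
      have hle : (3 * Real.sqrt Chi + 3 * Real.sqrt Nhi) ^ 2 ≤ ((s.2 : ℝ) / ((D : ℤ) : ℝ)) * ((s.2 : ℝ) / ((D : ℤ) : ℝ)) := by
        rw [sq]; exact mul_le_mul hvle hvle hv0 (hv0.trans hvle)
      unfold sqSum
      exact (mul_le_mul_of_nonneg_right hle hD.le).trans e2
    -- the right side, in fixed point
    have mR := mem_idivn (mem_iscale (bn * (3 * (L * L) ^ 2))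
      (mem_imul (mem_imul (mem_ipt C.eta.1) (mem_isub (mem_iscale 2 (mem_ipt S.eps1.1)) (mem_ipt C.thi))) (mem_ipt C.tlo)))
      (show (0 : ℤ) < (bd : ℤ) by exact_mod_cast hbd)
    obtain ⟨hRlo, -⟩ := mR
    have hineqR : ((sqSum C : ℤ) : ℝ) ≤ ((rhsLo L S C bn bd : ℤ) : ℝ) := by exact_mod_cast hineq
    unfold rhsLo at hineqR
    -- monotonicity: the fixed-point right side is below the real right side
    have hEta : ((C.eta.1 : ℤ) : ℝ) / ((D : ℤ) : ℝ) ≤ (L : ℝ) ^ 2 * lam2 / 4 := by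
      rw [div_le_iff₀ hD]; have := mEta.1; unfold etaEff at this; exact this
    have hEta0 : 0 ≤ ((C.eta.1 : ℤ) : ℝ) / ((D : ℤ) : ℝ) := by
      have : (0 : ℝ) ≤ ((C.eta.1 : ℤ) : ℝ) := by exact_mod_cast heta0
      positivity
    have hEps : ((S.eps1.1 : ℤ) : ℝ) / ((D : ℤ) : ℝ) ≤ eps1 L := by rw [div_le_iff₀ hD]; exact meps.1
    have hThi' : ((C.thi : ℤ) : ℝ) / ((D : ℤ) : ℝ) ≤ 2 * (((S.eps1.1 : ℤ) : ℝ) / ((D : ℤ) : ℝ)) := by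
      rw [div_le_iff₀ hD]
      have h1 : ((C.thi : ℤ) : ℝ) ≤ 2 * ((S.eps1.1 : ℤ) : ℝ) := by exact_mod_cast hthi
      have : 2 * (((S.eps1.1 : ℤ) : ℝ) / ((D : ℤ) : ℝ)) * ((D : ℤ) : ℝ) = 2 * ((S.eps1.1 : ℤ) : ℝ) := by
        field_simp
      linarith
    have hTlo0 : 0 ≤ ((C.tlo : ℤ) : ℝ) / ((D : ℤ) : ℝ) := by
      have : (0 : ℝ) ≤ ((C.tlo : ℤ) : ℝ) := by exact_mod_cast htlo0
      positivity
    have hbn : (0 : ℝ) ≤ bn := by positivity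
    have hbd' : (0 : ℝ) < bd := by exact_mod_cast hbd
    have hmono :
        ((bn * (3 * (L * L) ^ 2) : ℕ) : ℝ) *
            ((((C.eta.1 : ℤ) : ℝ) / ((D : ℤ) : ℝ)) * (((2 : ℕ) : ℝ) * (((S.eps1.1 : ℤ) : ℝ) / ((D : ℤ) : ℝ))
              - ((C.thi : ℤ) : ℝ) / ((D : ℤ) : ℝ)) * (((C.tlo : ℤ) : ℝ) / ((D : ℤ) : ℝ))) / ((bd : ℤ) : ℝ)
          ≤ ((bn : ℝ) / bd) * ((L : ℝ) ^ 2 * lam2 / 4) * (2 * eps1 L - ((C.thi : ℤ) : ℝ) / ((D : ℤ) : ℝ))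
              * (3 * ((L : ℝ) ^ 2) ^ 2 * (((C.tlo : ℤ) : ℝ) / ((D : ℤ) : ℝ))) := by
      have hA : (((C.eta.1 : ℤ) : ℝ) / ((D : ℤ) : ℝ)) * (((2 : ℕ) : ℝ) * (((S.eps1.1 : ℤ) : ℝ) / ((D : ℤ) : ℝ))
              - ((C.thi : ℤ) : ℝ) / ((D : ℤ) : ℝ))
          ≤ ((L : ℝ) ^ 2 * lam2 / 4) * (2 * eps1 L - ((C.thi : ℤ) : ℝ) / ((D : ℤ) : ℝ)) := by
        push_cast
        exact mul_le_mul hEta (by linarith) (by linarith) ((hEta0).trans hEta)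
      have hB := mul_le_mul_of_nonneg_right hA hTlo0
      have hC := mul_le_mul_of_nonneg_left hB (show (0 : ℝ) ≤ ((bn * (3 * (L * L) ^ 2) : ℕ) : ℝ) / ((bd : ℤ) : ℝ) by
        push_cast; positivity)
      have e1 : ((bn * (3 * (L * L) ^ 2) : ℕ) : ℝ) *
            ((((C.eta.1 : ℤ) : ℝ) / ((D : ℤ) : ℝ)) * (((2 : ℕ) : ℝ) * (((S.eps1.1 : ℤ) : ℝ) / ((D : ℤ) : ℝ))
              - ((C.thi : ℤ) : ℝ) / ((D : ℤ) : ℝ)) * (((C.tlo : ℤ) : ℝ) / ((D : ℤ) : ℝ))) / ((bd : ℤ) : ℝ)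
          = ((bn * (3 * (L * L) ^ 2) : ℕ) : ℝ) / ((bd : ℤ) : ℝ) *
            ((((C.eta.1 : ℤ) : ℝ) / ((D : ℤ) : ℝ)) * (((2 : ℕ) : ℝ) * (((S.eps1.1 : ℤ) : ℝ) / ((D : ℤ) : ℝ))
              - ((C.thi : ℤ) : ℝ) / ((D : ℤ) : ℝ)) * (((C.tlo : ℤ) : ℝ) / ((D : ℤ) : ℝ))) := by ring
      have e2 : ((bn * (3 * (L * L) ^ 2) : ℕ) : ℝ) / ((bd : ℤ) : ℝ) *
            (((L : ℝ) ^ 2 * lam2 / 4) * (2 * eps1 L - ((C.thi : ℤ) : ℝ) / ((D : ℤ) : ℝ)) * (((C.tlo : ℤ) : ℝ) / ((D : ℤ) : ℝ)))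
          = ((bn : ℝ) / bd) * ((L : ℝ) ^ 2 * lam2 / 4) * (2 * eps1 L - ((C.thi : ℤ) : ℝ) / ((D : ℤ) : ℝ))
              * (3 * ((L : ℝ) ^ 2) ^ 2 * (((C.tlo : ℤ) : ℝ) / ((D : ℤ) : ℝ))) := by push_cast; ring
      rw [e1]; rw [e2] at hC; exact hC
    have key : (3 * Real.sqrt Chi + 3 * Real.sqrt Nhi) ^ 2 * ((D : ℤ) : ℝ)
        ≤ ((bn : ℝ) / bd) * ((L : ℝ) ^ 2 * lam2 / 4) * (2 * eps1 L - ((C.thi : ℤ) : ℝ) / ((D : ℤ) : ℝ))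
              * (3 * ((L : ℝ) ^ 2) ^ 2 * (((C.tlo : ℤ) : ℝ) / ((D : ℤ) : ℝ))) * ((D : ℤ) : ℝ) := by
      refine hsq.trans (hineqR.trans (hRlo.trans ?_))
      exact mul_le_mul_of_nonneg_right hmono hD.le
    exact le_of_mul_le_mul_right key hD

end FinXB

end Summit.HubbardSuperconductivity.HubbardSuperconductivity.Theorems.AnisotropyChord.Transfer.Fibre3
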